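import Summits.BirchSwinnertonDyer.BirchSwinnertonDyer.Theses.UniversalToricDescent
import Summits.BirchSwinnertonDyer.BirchSwinnertonDyer.Theorems.UniversalToricDescentToricTransportModThreeStubRatSqueeze
import Literature.NumberTheory.EllipticCurves.HeegnerModuleIndex
import Literature.NumberTheory.GaloisRepresentations.AbsGaloisGroup
import HarnessLib

/-!
# Line `ghost_reciprocity` — crux idea #36 (crux-ideate g28) for `AdditiveSplitIMCInclusionAtThree` (stmt-…-20395)

NODE (D-0171 shape): a compiling file concluding the crux BY NAME from five pieces, each tagged.

THE LEVER (new on this crux: no `p`-adic `L`-function, no explicit reciprocity LAW, no Kolyvagin / Euler system,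
no comparison of periods).  Write `X = X_(∅ at 𝔭, 0 at 𝔭′)(E/K_∞^ac)` (the crux's `XAc (W.baseChange K) 3 κ 𝔭' ∅ γ`).
By the landed `wall_iff_ratwall_and_muDominance` and 3-saturation (`RatwallThinComb.dvd_of_dvd_prime_pow_mul`),
WALL ⟸ RATWALL ∧ (X is Λ-torsion with `3 ∤ char`), and `3 ∤ char X ∧ torsion ⟸ Sel_(∅,0)(K_∞, E[3^∞])[3] finite`
(`GhostCriterion`, structure theory).  A *mod-3 ghost* is a nonzero corestriction-compatible family
`(κ_s)_s`, `κ_s ∈ Sel_(∅ at 𝔭, 0 at 𝔭′)(K_s, E[3])`; by the Euler–Poincaré count for `𝔽₃⟦T⟧`-modules and the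
`c`-symmetry `r₃(X_(0,∅)) = r₃(X_(∅,0))`, `μ(X) > 0 ⟺ a ghost exists`.  GLOBAL RECIPROCITY `Σ_w inv_w(κ_s ∪ b) = 0`
against every `b ∈ Sel₃(E/K_s)` (finite everywhere; the `𝔭′`-terms vanish because `κ_s` is strict there) forces the
singular part `∂_𝔭 κ_s ∈ ⊕_{w ∣ 𝔭} H¹_s(K_{s,w}, E[3]) ≅ (⊕_w E(K_{s,w})/3)^∨` to annihilate the image of
`Sel₃(E/K_s)`.  If that image has BOUNDED CODIMENSION — equivalently (Poitou–Tate) the `𝔭`-RELAXATION DEFECT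
`[Sel₃^{𝔭-rel}(E/K_s) : Sel₃(E/K_s)] ≤ 3^C` (`RelaxationDefectBounded`, INSTRUMENTABLE: the Selmer classes are supplied by the
`3^s + O(1)` independent Heegner points over `K_s`, Cornut–Vatsal + Bertolini–Darmon) — then `dim ∂_𝔭 κ_s ≤ C'` for all `s`,
whereas the image of a nonzero free `𝔽₃⟦T⟧`-module of ghosts in `lim← ⊕_w H¹_s` is `0` or unbounded
(`lim←_s ⊕_w E(K_{s,w})/3 = 0`: no universal traces of local points mod 3 in the deeply ramified potentially
supersingular tower, Coates–Greenberg 1996); so the ghost is DOUBLY STRICT, `r₃(X_(∅,∅)) ≥ 3 > rank_Λ = 2`, and by the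
reflection `μ(X_(∅,∅)) = μ(X_(0,0))` (Greenberg 1989 Thm 2 / Flach 1990) the FINE Selmer group has `μ > 0`.
Contrapositive = `GhostTransfer`: RelaxationDefectBounded(𝔭) ∧ μ(X_fine) = 0 ⟹ Sel_(∅,0)(K_∞)[3] finite.

Pieces: S-μ3 `RelaxationDefect` (UNDECIDED · INSTRUMENTABLE) · S-μ4 `FineMuZero` (WEAKER than the goal · UNDECIDED; the
anticyclotomic Conjecture-A leaf, B-g12-4/F-g12-cl) · S-μ2 `GhostTransfer` (THE LEVER · UNDECIDED · ATTACKABLE) · S-μ1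
`GhostCriterion` (ATTACKABLE, structure theory of Λ-modules) · S5 `RationalSplitIMCInclusionAtThree` (WEAKER, = LEAD 24207).
Kernel `AdditiveSplitIMCInclusionAtThree_of` is sorry-free; sorries only in `stub_*`.

Sources: PerrinRiou1987BSMF §0; GreenbergLNM1716 §§2–4; Greenberg1989 (Adv. Stud. Pure Math. 17) Thm 2; Flach1990 (Crelle 412);
CoatesGreenberg1996 (Invent. 124) §4; CoatesSujatha2005 (Math. Ann. 331) Conj. A; CornutVatsal / Cornut2002 (Invent. 148);
BertoliniDarmon1990 (Crelle 412); MazurRubin2004 §2.3 (Euler–Poincaré for Selmer structures); Washington1997 §13.2.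
-/
set_option linter.dupNamespace false
set_option autoImplicit false

noncomputable section

open Literature.NumberTheory.EllipticCurves
open Literature.NumberTheory.GaloisRepresentations
open Summit.BirchSwinnertonDyer.BirchSwinnertonDyer.Theses.UniversalToricDescent
  (RationalSplitIMCInclusionAtThree AdditiveSplitIMCInclusionAtThree)
open Summit.BirchSwinnertonDyer.BirchSwinnertonDyer.Cruxes.ToricTransportModThree.RatwallThinComb
  (dvd_of_dvd_prime_pow_mul prime_C_three)
open Summit.BirchSwinnertonDyer.Rank1Residual.X11b
open IsDedekindDomain NumberField Field

namespace Summit.BirchSwinnertonDyer.BirchSwinnertonDyer.Cruxes.AdditiveSplitIMCInclusionAtThree.GhostReciprocity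

/-! ## §0 Objects -/

/-- The `μ`-prime of `R₀⟦T⟧`: the constant series `3`. -/
abbrev threeC : UnrSeries 3 := PowerSeries.C ((3 : ℕ) : unrIntegers 3)

/-- The `μ = 0` package in divisibility currency (VERBATIM from `Lines/diagonal_waldspurger.lean`, #33/#35):
`X_(∅ at the other prime, 0 at 𝔮)` is Λ-torsion and its characteristic series in `R₀⟦T⟧` is not divisible by `3`.
[GreenbergVatsal2000 §2; Washington1997 §13.2] -/
def MuZeroPackage (W : WeierstrassCurve ℚ) (K : Type) [Field K] [NumberField K] (κ' : ZpExtension K 3)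
    (𝔮 : HeightOneSpectrum (𝓞 K)) (γ' : absoluteGaloisGroup K) [Fact (κ'.IsTopGenerator γ')] : Prop :=
  Module.IsTorsion (IwasawaAlgebra 3) (AcSelmer.XAc (W.baseChange K) 3 κ' 𝔮 ∅ γ') ∧
    ∃ g' : UnrSeries 3,
      (AcSelmer.XAc.charIdeal (W.baseChange K) 3 κ' 𝔮 ∅ γ').map (PowerSeries.map (Halves.toUnr 3)) =
          Ideal.span {g'} ∧ ¬ threeC ∣ g'

section Residual

variable {K : Type} [Field K] [NumberField K]

/-- **Residual finiteness** of Castella's anticyclotomic Selmer group strict at `𝔮` (relaxed at the other prime above `3`,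
trivial away from `3`): `Sel_(∅,0)(K_∞, E[3^∞])[3]` is finite.  Since `E(K_∞)[3] = 0` (ρ̄ onto) this is
`Sel_(∅,0)(K_∞, E[3])` finite, i.e. `μ(X) = 0` AND `X` cotorsion ("no mod-3 ghost"). [GreenbergLNM1716 §4; Washington1997 §13.2] -/
def ResidualFinite (W' : WeierstrassCurve K) (κ : ZpExtension K 3) (𝔮 : HeightOneSpectrum (𝓞 K)) : Prop :=
  {c : ↥(AcSelmer.selmerAc W' 3 κ 𝔮 ∅) | (3 : ℕ) • c = 0}.Finite

/-- **Fine residual finiteness**: the FINE (doubly strict) anticyclotomic Selmer group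
`Sel_(0,0)(K_∞, E[3^∞]) = Sel_(strict at 𝔭′) ⊓ Sel_(strict at 𝔭)` has finite `3`-torsion — `μ(X_fine) = 0`
(the anticyclotomic analogue of Coates–Sujatha's Conjecture A; `X_fine` is a quotient of the torsion `X_(∅,0)`).
[CoatesSujatha2005 Conj. A; PerrinRiou1987BSMF §0] -/
def FineResidualFinite (W' : WeierstrassCurve K) (κ : ZpExtension K 3) (𝔭 𝔭' : HeightOneSpectrum (𝓞 K)) : Prop :=
  {c : ↥(AcSelmer.selmerAc W' 3 κ 𝔭' ∅ ⊓ AcSelmer.selmerAc W' 3 κ 𝔭 ∅) | (3 : ℕ) • c = 0}.Finite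

/-- The **`𝔭`-relaxed `m`-Selmer group** of `E` over `L = K̄^H`: the tree's `selmerTorsionOver` (Perrin-Riou 1987 §0: local
conditions at every place of `L`, through every `Γ_K`-conjugate of the chosen embedding) with the conditions at the places
ABOVE `𝔭` OMITTED.  [PerrinRiou1987BSMF §0 p. 401; MazurRubin2004 §2.1 (Selmer structures, relaxing at a prime)] -/
def relaxedSelmerTorsionOver (W' : WeierstrassCurve K) (H : Subgroup (absoluteGaloisGroup K)) [H.Normal] (m : ℤ)
    (𝔭 : HeightOneSpectrum (𝓞 K)) : AddSubgroup (W'.torsionH1Over m H) :=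
  (⨅ (v : HeightOneSpectrum (𝓞 K)) (_ : v ≠ 𝔭) (σ : absoluteGaloisGroup K),
      (W'.localResTorsionOverOfEmb m H (closureEmb (K := K) (v.adicCompletion K))).ker.comap
        (Literature.NumberTheory.EllipticCurves.conjH1 H (WeierstrassCurve.geomTorsion W' m) σ)) ⊓
    ⨅ (w : InfinitePlace K) (σ : absoluteGaloisGroup K),
      (W'.localResTorsionOverOfEmb m H (closureEmb (K := K) w.Completion)).ker.comap
        (Literature.NumberTheory.EllipticCurves.conjH1 H (WeierstrassCurve.geomTorsion W' m) σ)

/-- Sanity: relaxing at `𝔭` enlarges the Selmer group. [MazurRubin2004 §2.1] -/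
theorem selmerTorsionOver_le_relaxed (W' : WeierstrassCurve K) (H : Subgroup (absoluteGaloisGroup K)) [H.Normal] (m : ℤ)
    (𝔭 : HeightOneSpectrum (𝓞 K)) : W'.selmerTorsionOver H m ≤ relaxedSelmerTorsionOver W' H m 𝔭 :=
  inf_le_inf (iInf_mono fun _ ↦ le_iInf fun _ ↦ le_rfl) le_rfl

/-- **`𝔭`-relaxation defect bounded along the anticyclotomic tower**: `[Sel₃^{𝔭-rel}(E/K_s) : Sel₃(E/K_s)] ≤ 3^C` for every
layer `K_s = K̄^{κ.layerSubgroup s}`.  By Poitou–Tate this index is `3^{codim}`, `codim` = the codimension of the image of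
`Sel₃(E/K_s)` in the semi-local points mod `3` above `𝔭`, `⊕_{w ∣ 𝔭} E(K_{s,w})/3E(K_{s,w})` (dimension `3^s + O(1)`): the
statement says the `3`-Selmer classes (Heegner points of `3`-power conductor: `rank E(K_s) = 3^s + O(1)`) FILL the local points
mod `3` at `𝔭` up to a bounded defect.  [MazurRubin2004 Thm 2.3.4 (global duality for Selmer structures); Cornut2002;
BertoliniDarmon1990] -/
def RelaxationDefectBounded (W' : WeierstrassCurve K) (κ : ZpExtension K 3) (𝔭 : HeightOneSpectrum (𝓞 K)) : Prop :=
  ∃ C : ℕ, ∀ s : ℕ,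
    0 < (W'.selmerTorsionOver (κ.layerSubgroup s) 3).relIndex (relaxedSelmerTorsionOver W' (κ.layerSubgroup s) 3 𝔭) ∧
      (W'.selmerTorsionOver (κ.layerSubgroup s) 3).relIndex (relaxedSelmerTorsionOver W' (κ.layerSubgroup s) 3 𝔭) ≤ 3 ^ C

end Residual

/-! ## §1 The five pieces as `Prop`s (row schema = the crux's binders up to `𝔭′ ≠ 𝔭`) -/

/-- **S-μ1 `GhostCriterion`** (ATTACKABLE — structure theory): `Sel_(∅,0)(K_∞)[3]` finite ⟹ `X_(∅,0)` is Λ-torsion with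
`3 ∤ char` in `R₀⟦T⟧`.  (Pontryagin duality `X/3X ≅ (Sel[3])^∨` finite ⟹ `X` f.g. over `ℤ₃` by compact Nakayama ⟹ torsion,
`μ = 0`; `Halves.toUnr` is injective on `ℤ₃⟦T⟧` and `3` stays prime in `R₀⟦T⟧`.) [Washington1997 §13.2 Lemma 13.16 + Prop. 13.23;
GreenbergLNM1716 §4] -/
def GhostCriterion : Prop :=
    ∀ (W : WeierstrassCurve ℚ) [W.IsElliptic] [W.IsGloballyMinimal] (N : ℕ) [NeZero N] (K : Type) [Field K]
      [NumberField K],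
    Summit.BirchSwinnertonDyer.Rank1Residual.Additive.ClassO6 W 3 → W.HasSurjectiveModNGaloisRep 3 →
    W.analyticRank = 1 → W.conductorNorm ℤ = N → IsImaginaryQuadratic K → SatisfiesHeegnerHypothesis N K →
    ∀ (κ : ZpExtension K 3), κ.IsAnticyclotomic → ∀ (γ : Field.absoluteGaloisGroup K) [Fact (κ.IsTopGenerator γ)]
      (𝔭 : HeightOneSpectrum (𝓞 K)), ((3 : ℕ) : 𝓞 K) ∈ 𝔭.asIdeal →
      𝔭.asIdeal.ramificationIdx (𝓞 ℚ) = 1 → 𝔭.asIdeal.inertiaDeg (𝓞 ℚ) = 1 →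
    ∀ (𝔭' : HeightOneSpectrum (𝓞 K)), ((3 : ℕ) : 𝓞 K) ∈ 𝔭'.asIdeal → 𝔭' ≠ 𝔭 →
    ResidualFinite (W.baseChange K) κ 𝔭' → MuZeroPackage W K κ 𝔭' γ

/-- **S-μ2 `GhostTransfer`** — THE LEVER (UNDECIDED · ATTACKABLE): bounded `𝔭`-relaxation defect and `μ(X_fine) = 0` ⟹ no mod-3
ghost in `Sel_(∅ at 𝔭, 0 at 𝔭′)`.  Internal steps (each a printed technique, none a reciprocity law): (a) Euler–Poincaré for the
compact `𝔽₃⟦T⟧`-Selmer modules + `c`-symmetry `r₃(X_(0,∅)) = r₃(X_(∅,0))`; (b) global reciprocity of the ghost against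
`Sel₃(E/K_s)` ⟹ `dim ∂_𝔭 κ_s ≤ codim_s ≤ C'`; (c) no universal traces of local points mod `3` in the deeply ramified pot.-ss tower
at `𝔭` (Coates–Greenberg) ⟹ `loc_𝔭(ghost) = 0`; (d) `rank_Λ X_(∅,∅) = 2` (from `X_(∅,0)` torsion) ⟹ `μ(X_(∅,∅)) > 0`;
(e) reflection `μ(X_(∅,∅)) = μ(X_(0,0))`.  Why it might fail: (c) needs `H¹_Iw(K_{∞,𝔭}, E[3])` torsion-free and the
finite-layer control `Sel(K_s,E[3]) → Sel(K_∞,E[3^∞])[ω_s,3]` with bounded kernel/cokernel at the relaxed prime; (e) is in print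
for Greenberg's self-dual structures, the `(∅,∅)/(0,0)` pair needs Flach's pairing for these local conditions.
[MazurRubin2004 Thm 2.3.4, Prop. 2.3.5; CoatesGreenberg1996 Props. 4.3, 4.8; Greenberg1989 Thm 2; Flach1990; PerrinRiou1987BSMF §§0–1] -/
def GhostTransfer : Prop :=
    ∀ (W : WeierstrassCurve ℚ) [W.IsElliptic] [W.IsGloballyMinimal] (N : ℕ) [NeZero N] (K : Type) [Field K]
      [NumberField K],
    Summit.BirchSwinnertonDyer.Rank1Residual.Additive.ClassO6 W 3 → W.HasSurjectiveModNGaloisRep 3 →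
    W.analyticRank = 1 → W.conductorNorm ℤ = N → IsImaginaryQuadratic K → SatisfiesHeegnerHypothesis N K →
    ∀ (κ : ZpExtension K 3), κ.IsAnticyclotomic → ∀ (γ : Field.absoluteGaloisGroup K) [Fact (κ.IsTopGenerator γ)]
      (𝔭 : HeightOneSpectrum (𝓞 K)), ((3 : ℕ) : 𝓞 K) ∈ 𝔭.asIdeal →
      𝔭.asIdeal.ramificationIdx (𝓞 ℚ) = 1 → 𝔭.asIdeal.inertiaDeg (𝓞 ℚ) = 1 →
    ∀ (𝔭' : HeightOneSpectrum (𝓞 K)), ((3 : ℕ) : 𝓞 K) ∈ 𝔭'.asIdeal → 𝔭' ≠ 𝔭 →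
    RelaxationDefectBounded (W.baseChange K) κ 𝔭 → FineResidualFinite (W.baseChange K) κ 𝔭 𝔭' →
    ResidualFinite (W.baseChange K) κ 𝔭'

/-- **S-μ3 `RelaxationDefect`** (UNDECIDED · INSTRUMENTABLE): on every row the `𝔭`-relaxation defect of the `3`-Selmer group is
bounded up the anticyclotomic tower — the Heegner/Selmer classes over `K_s` fill `⊕_{w ∣ 𝔭} E(K_{s,w})/3` up to `O(1)`.
Instrument: for `s = 0, 1` on sample O6 rows (27a, 54b, …) compute `dim_{𝔽₃}` of the image of the known generators of
`E(K_s)` in `E(K_{s,w})/3` (3-adic logarithms / formal-group filtration at the pot.-ss prime).  Why it might fail: systematic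
local `3`-divisibility of CM points at the additive prime (the trace-zero relation `Tr z_{s+1} = a₃ z_s - z_{s-1}` with
`a₃ = 0` pushes traces into `3·E(K_{s,w})`-cosets), i.e. the teeth gauges of #3/#7 could force a defect growing like `c·3^s`.
[Cornut2002 Thm B; BertoliniDarmon1990 §2; Kobayashi2003 §8 (local points in the ss tower); MazurRubin2004 Thm 2.3.4] -/
def RelaxationDefect : Prop :=
    ∀ (W : WeierstrassCurve ℚ) [W.IsElliptic] [W.IsGloballyMinimal] (N : ℕ) [NeZero N] (K : Type) [Field K]
      [NumberField K],
    Summit.BirchSwinnertonDyer.Rank1Residual.Additive.ClassO6 W 3 → W.HasSurjectiveModNGaloisRep 3 →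
    W.analyticRank = 1 → W.conductorNorm ℤ = N → IsImaginaryQuadratic K → SatisfiesHeegnerHypothesis N K →
    ∀ (κ : ZpExtension K 3), κ.IsAnticyclotomic → ∀ (γ : Field.absoluteGaloisGroup K) [Fact (κ.IsTopGenerator γ)]
      (𝔭 : HeightOneSpectrum (𝓞 K)), ((3 : ℕ) : 𝓞 K) ∈ 𝔭.asIdeal →
      𝔭.asIdeal.ramificationIdx (𝓞 ℚ) = 1 → 𝔭.asIdeal.inertiaDeg (𝓞 ℚ) = 1 →
    ∀ (𝔭' : HeightOneSpectrum (𝓞 K)), ((3 : ℕ) : 𝓞 K) ∈ 𝔭'.asIdeal → 𝔭' ≠ 𝔭 →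
    RelaxationDefectBounded (W.baseChange K) κ 𝔭

/-- **S-μ4 `FineMuZero`** (WEAKER than the goal · UNDECIDED): `μ = 0` for the FINE anticyclotomic Selmer group on every row — the
residual leaf (class-group avatar: `μ` of the `ω`-parts of `Cl(K_s(E[3]))[3]`, KEEPKILL-g12 F-g12-cl / B-g12-4).  Why it might
fail: open in general (Conjecture A is known over `K_cyc` only where `μ(K(E[p])_cyc) = 0`); no anticyclotomic transfer in print
at an additive prime. [CoatesSujatha2005 Thm 3.4, Conj. A; LimMurty2016 (fine Selmer & class groups)] -/
def FineMuZero : Prop :=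
    ∀ (W : WeierstrassCurve ℚ) [W.IsElliptic] [W.IsGloballyMinimal] (N : ℕ) [NeZero N] (K : Type) [Field K]
      [NumberField K],
    Summit.BirchSwinnertonDyer.Rank1Residual.Additive.ClassO6 W 3 → W.HasSurjectiveModNGaloisRep 3 →
    W.analyticRank = 1 → W.conductorNorm ℤ = N → IsImaginaryQuadratic K → SatisfiesHeegnerHypothesis N K →
    ∀ (κ : ZpExtension K 3), κ.IsAnticyclotomic → ∀ (γ : Field.absoluteGaloisGroup K) [Fact (κ.IsTopGenerator γ)]
      (𝔭 : HeightOneSpectrum (𝓞 K)), ((3 : ℕ) : 𝓞 K) ∈ 𝔭.asIdeal →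
      𝔭.asIdeal.ramificationIdx (𝓞 ℚ) = 1 → 𝔭.asIdeal.inertiaDeg (𝓞 ℚ) = 1 →
    ∀ (𝔭' : HeightOneSpectrum (𝓞 K)), ((3 : ℕ) : 𝓞 K) ∈ 𝔭'.asIdeal → 𝔭' ≠ 𝔭 →
    FineResidualFinite (W.baseChange K) κ 𝔭 𝔭'

/-! ## §2 Registered stubs (sorries live ONLY here) -/

/-- S-μ1 (ATTACKABLE · structure theory). -/
theorem stub_ghostCriterion : GhostCriterion := by
  sorry

/-- S-μ2 (THE LEVER · UNDECIDED · ATTACKABLE). -/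
theorem stub_ghostTransfer : GhostTransfer := by
  sorry

/-- S-μ3 (UNDECIDED · INSTRUMENTABLE). -/
theorem stub_relaxationDefect : RelaxationDefect := by
  sorry

/-- S-μ4 (WEAKER · UNDECIDED · residual leaf). -/
theorem stub_fineMuZero : FineMuZero := by
  sorry

/-- S5 = RATWALL (WEAKER · the LEAD line 24207 `ratwall_thin_comb`). -/
theorem stub_ratwall : RationalSplitIMCInclusionAtThree := by
  sorry

/-! ## §3 Kernel: the five pieces ⟹ the crux BY NAME (sorry-free) -/

/-- **TOP COMPOSITION (g28)** — `RelaxationDefect → FineMuZero → GhostTransfer → GhostCriterion → RATWALL ⟹ WALL`: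
ghost transfer gives residual finiteness of `Sel_(∅ at 𝔭, 0 at 𝔭′)(K_∞)`, the criterion turns it into the `μ = 0` package
`(char) = (g)`, `3 ∤ g`, and the landed `3`-saturation squeezes RATWALL's `g ∣ 3^k·L` to `g ∣ L`. -/
theorem AdditiveSplitIMCInclusionAtThree_of :
    RelaxationDefect → FineMuZero → GhostTransfer → GhostCriterion → RationalSplitIMCInclusionAtThree →
      Summit.BirchSwinnertonDyer.BirchSwinnertonDyer.Theses.UniversalToricDescent.AdditiveSplitIMCInclusionAtThree := by
  intro hT hF hG hC hR W _ _ N _ K _ _ Dt hO6 hsurj hrk hN hK hH κ hκ γ hγ 𝔭 h3 hram hdeg 𝔭' h3' hne ι' hι ΩK Ωp L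
    hΩK hΩp hL
  -- S5: the rational wall, `3^k₀ · L ∈ Ch·R₀⟦T⟧`
  obtain ⟨k₀, hk⟩ := hR W N K Dt hO6 hsurj hrk hN hK hH κ hκ γ 𝔭 h3 hram hdeg 𝔭' h3' hne ι' hι ΩK Ωp L hΩK hΩp hL
  -- S-μ3, S-μ4: the two leaves on this row
  have hdef : RelaxationDefectBounded (W.baseChange K) κ 𝔭 :=
    hT W N K hO6 hsurj hrk hN hK hH κ hκ γ 𝔭 h3 hram hdeg 𝔭' h3' hne
  have hfine : FineResidualFinite (W.baseChange K) κ 𝔭 𝔭' :=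
    hF W N K hO6 hsurj hrk hN hK hH κ hκ γ 𝔭 h3 hram hdeg 𝔭' h3' hne
  -- S-μ2: ghost transfer ⟹ no mod-3 ghost in `Sel_(∅,0)`
  have hres : ResidualFinite (W.baseChange K) κ 𝔭' :=
    hG W N K hO6 hsurj hrk hN hK hH κ hκ γ 𝔭 h3 hram hdeg 𝔭' h3' hne hdef hfine
  -- S-μ1: residual finiteness ⟹ the `μ = 0` package
  obtain ⟨-, g, hg, hndvd⟩ := hC W N K hO6 hsurj hrk hN hK hH κ hκ γ 𝔭 h3 hram hdeg 𝔭' h3' hne hres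
  -- landed `3`-saturation
  rw [hg] at hk ⊢
  have hdvd : g ∣ ((3 : ℕ) : UnrSeries 3) ^ k₀ * L := Ideal.mem_span_singleton.mp hk
  rw [← map_natCast (PowerSeries.C (R := unrIntegers 3))] at hdvd
  exact Ideal.span_singleton_le_span_singleton.mpr (dvd_of_dvd_prime_pow_mul prime_C_three hndvd k₀ hdvd)

/-- Instance of the composition with the registered stubs (shows the node is wired; inherits their sorries). -/
theorem AdditiveSplitIMCInclusionAtThree_of_stubs :
    Summit.BirchSwinnertonDyer.BirchSwinnertonDyer.Theses.UniversalToricDescent.AdditiveSplitIMCInclusionAtThree :=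
  AdditiveSplitIMCInclusionAtThree_of stub_relaxationDefect stub_fineMuZero stub_ghostTransfer stub_ghostCriterion
    stub_ratwall

end Summit.BirchSwinnertonDyer.BirchSwinnertonDyer.Cruxes.AdditiveSplitIMCInclusionAtThree.GhostReciprocity

end
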